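import Literature.NumberTheory.IwasawaTheory.ClassicalMuVanishesSplitCartanFiveIndexTwoAbelian
import Literature.NumberTheory.EllipticCurves.FineSelmerClassGroupCriterionThm34Proofs
import HarnessLib

set_option autoImplicit false

/-!
# Statement (A) at `p = 5` on the INDEX-2 split-Cartan rows (`G₁₆ ≅ M₁₆`) with NO named fact: Ferrero–Washington replaced by the four
# abelian leaves `K″`, `ℚ(ζ₅)`, `L^⟨σ̄_a⟩`, `L^⟨σ̄_a², σ̄_aσ̄_s⟩` of `ℚ(E[5])`

Topic `NumberTheory/EllipticCurves`; THEOREM-ONLY file (no definition, no named fact, no `sorry`), written by the prover seat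
`bsd-potss-k8t-c4` g24 (cell `bsd-potss`; supports the KT U₀ node stmt-BirchSwinnertonDyer-19982 and the Conj-A items 19413 / 19916 at
the row 446400hu1; closes nothing).  Twin of `FineSelmerMuRoadSplitCartanFiveIndexTwo.fineSelmerDual_moduleFinite_of_splitCartanIndexTwoBasis_five`
(k8t-c4 g18: modulo `hCS` + `hFW`) with BOTH named facts gone: Coates–Sujatha Thm. 3.4 is the tree theorem `thm34_…_holds` (g22) and
Ferrero–Washington is replaced — by `ClassicalMuVanishesSplitCartanFiveIndexTwoAbelian` (g24) — by «`μ = 0` for every cyclotomic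
`ℤ_5`-extension» of the four ABELIAN fixed fields `K″ = ℚ(E[5])^⟨σ̄_a⁴, σ̄_s⟩` (cyclic quartic `⊇ ℚ(√5)`), `Z = ℚ(E[5])^⟨σ̄_a²σ̄_s⟩` (`= ℚ(ζ₅)`),
`ℚ(E[5])^⟨σ̄_a⟩` and `ℚ(E[5])^⟨σ̄_a², σ̄_aσ̄_s⟩` (quadratic), inputs a finite class-group computation certifies (Iwasawa 1956, a tree theorem).

References: [CoatesSujatha2005] Thm. 3.4; [Washington1997] §13.1; [Serre1972] §2.2; [Lemmermeyer1994] §1.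
-/

noncomputable section

open scoped NumberField Matrix

open Field IntermediateField WeierstrassCurve Literature.NumberTheory.EllipticCurves Literature.NumberTheory.GaloisRepresentations
  Literature.NumberTheory.SerreUniformity Literature.NumberTheory.IwasawaTheory

namespace Literature.NumberTheory.EllipticCurves.CoatesSujatha2005

/-- **Statement (A) at `5` for an index-2 split-Cartan basis (`G₁₆ ≅ M₁₆`), NO named fact.**  `E/ℚ` elliptic; `e` a basis of `E[5]` in which
every `σ ∈ Γ_ℚ` acts through a matrix `M ∈ splitCartanNormalizer 5` of shape `c·1`, `c·diag(1,4)`, `c·(0 1; 2 0)` or `c·(0 1; 3 0)`; `σ_s, σ_a ∈ Γ_ℚ`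
acting as `diag(1,4)` and `(0 1; 2 0)`; `μ = 0` (growth form) for every cyclotomic `ℤ_5`-extension of the fixed fields in `ℚ(E[5])` of `⟨σ̄_s⟩`
(`= ℚ(P₁)`, 8), `⟨σ̄_a⁴, σ̄_s⟩` (`K″`, 4), `⟨σ̄_a²σ̄_s⟩` (`= ℚ(ζ₅)`, 4), `⟨σ̄_a⟩` (2) and `⟨σ̄_a², σ̄_aσ̄_s⟩` (2); then the dual fine Selmer group of `E`
over `ℚ_cyc` is finitely generated over `ℤ_5` (Coates–Sujatha Thm. 3.4, PROVED in the tree, ∘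
`classicalMuVanishes_divisionField_of_splitCartanIndexTwoBasis_five_abelian`). [cite: CoatesSujatha2005, Thm. 3.4 (§3)] [cite: Washington1997, §13.1]
[cite: Serre1972, §2.2 (split Cartan subgroups, normalisers)] [cite: Lemmermeyer1994, §1 (Kuroda's class number formula, odd part)] -/
theorem fineSelmerDual_moduleFinite_of_splitCartanIndexTwoBasis_five_abelian [Fact (Nat.Prime 5)] (W : WeierstrassCurve ℚ) [W.IsElliptic]
    (e : W.geomTorsion (5 : ℕ) ≃+ (Fin 2 → ZMod 5))
    (he : ∀ σ : absoluteGaloisGroup ℚ, ∃ M ∈ splitCartanNormalizer 5, (M 1 1 = M 0 0 ∨ M 1 1 = 4 * M 0 0) ∧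
      (M 1 0 = 2 * M 0 1 ∨ M 1 0 = 3 * M 0 1) ∧ ∀ P : W.geomTorsion (5 : ℕ), e (σ • P) = M *ᵥ e P)
    (σs σa : absoluteGaloisGroup ℚ) (hσs : ∀ P : W.geomTorsion (5 : ℕ), e (σs • P) = !![1, 0; 0, 4] *ᵥ e P)
    (hσa : ∀ P : W.geomTorsion (5 : ℕ), e (σa • P) = !![0, 1; 2, 0] *ᵥ e P)
    (hμP : ∀ κE : ZpExtension ↥(fixedField (Subgroup.zpowers (absRestrictNormalHom (W.divisionField 5) σs))) 5,
      κE.IsCyclotomic → ClassicalMuVanishes κE)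
    (hμK : ∀ κE : ZpExtension ↥(fixedField (Subgroup.zpowers (absRestrictNormalHom (W.divisionField 5) σa * absRestrictNormalHom (W.divisionField 5) σa *
        (absRestrictNormalHom (W.divisionField 5) σa * absRestrictNormalHom (W.divisionField 5) σa)) ⊔ Subgroup.zpowers (absRestrictNormalHom (W.divisionField 5) σs))) 5,
      κE.IsCyclotomic → ClassicalMuVanishes κE)
    (hμZ : ∀ κE : ZpExtension ↥(fixedField (Subgroup.zpowers (absRestrictNormalHom (W.divisionField 5) σa * absRestrictNormalHom (W.divisionField 5) σa *
        absRestrictNormalHom (W.divisionField 5) σs))) 5, κE.IsCyclotomic → ClassicalMuVanishes κE)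
    (hμQ : ∀ κE : ZpExtension ↥(fixedField (Subgroup.zpowers (absRestrictNormalHom (W.divisionField 5) σa))) 5,
      κE.IsCyclotomic → ClassicalMuVanishes κE)
    (hμR : ∀ κE : ZpExtension ↥(fixedField (Subgroup.zpowers (absRestrictNormalHom (W.divisionField 5) σa * absRestrictNormalHom (W.divisionField 5) σa) ⊔
        Subgroup.zpowers (absRestrictNormalHom (W.divisionField 5) σa * absRestrictNormalHom (W.divisionField 5) σs))) 5,
      κE.IsCyclotomic → ClassicalMuVanishes κE)
    (κ : ZpExtension ℚ 5) (hκ : κ.IsCyclotomic) :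
    ∃ (γ : absoluteGaloisGroup ℚ) (D : W.FineSelmerDualData κ γ), Module.Finite ℤ_[5] (RestrictScalars ℤ_[5] (IwasawaAlgebra 5) D.X) :=
  thm34_fineSelmerDual_moduleFinite_of_classicalMuVanishes_divisionField_holds W 5 (by decide)
    (classicalMuVanishes_divisionField_of_splitCartanIndexTwoBasis_five_abelian W e he σs σa hσs hσa hμP hμK hμZ hμQ hμR) κ hκ

end Literature.NumberTheory.EllipticCurves.CoatesSujatha2005

end
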